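import Literature.Analysis.OperatorTheory.SlabFibreContraction
import HarnessLib

/-!
# Stub `stub_slabContraction` (T4) for the crux `WeakCouplingHypercubicLimit` (line `Sketch`)

**Slab operators: integrating out the fibre variables and the block interiors** (abstract measure theory; the
path-space half of Osterwalder–Seiler 1978 §2: observables of finite time-width become bounded bond kernels dominated
by `‖A‖∞ 𝕋ʷ`).  Setting: probability spaces `(X, μ)` (slices) and `(Γ, ν)` (fibres), a bounded measurable non-negative
three-point weight `c(x, γ, x')` (one time step), the cycle `ℤ/N` with weight `∏ₜ c(xₜ, γₜ, xₜ₊₁)` under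
`μ^{⊗N} ⊗ ν^{⊗N}`, two bounded measurable block observables `α` (sites `0..r+1`, fibres `0..r`) and `β` (sites
`r+a+3..2r+a+4`), `N = 2r + a + b' + 6`; the fibre-averaged kernel `K(x,x') = ∫ c(x,γ,x') dν` and the contracted block
kernels `X_α(u,u') = ∫∫ α(u ∷ v :: u', γ⃗) ∏ᵢ c dν^{⊗(r+1)} dμ^{⊗r}`, `X_β`, all three entering as variables with their
defining equations (registered form r5 — the r3 form with the kernels written inline exceeded the ledger's signature
length).  Claims: (a) `X_α`, `X_β` jointly strongly measurable; (b) `|X_α| ≤ C_α ∫ ∏ᵢ K dμ^{⊗r}`, `|X_α| ≤ C_α C_c^{r+1}`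
(same for `β`); (c)/(d)/(e) the cyclic integrals with two / one / no block equal the heterogeneous cyclic integrals of
the shapes of `integral_cyclic_insert_two` / `integral_cyclic_insert_one` / the pure `K`-cycle.  Everything is the
Literature toolkit `SlabFibreContraction` (worker T4 of the lead's wave, p125225): `slab_blockKernel_stronglyMeasurable`,
`slab_blockKernel_abs_le`, `slab_blockKernel_abs_le'`, `slab_cyclic_two`, `slab_cyclic_one`, `slab_cyclic_zero`. [folklore]
-/

noncomputable section

open scoped BigOperators
open MeasureTheory Filter
open Literature.Analysis.OperatorTheory

namespace Summit.QuantumFields.YangMills.Theorems.WeakCouplingHypercubicLimit.TraceNormColdPressure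

/-- `stub_slabContraction` (T4, registered form r5) — **slab operators: integrating out the fibre variables and the
block interiors**; see the module docstring. [folklore] -/
theorem stub_slabContraction :
    ∀ (X Γ : Type) [MeasurableSpace X] [MeasurableSpace Γ] (μ : Measure X) (ν : Measure Γ)
      [IsProbabilityMeasure μ] [IsProbabilityMeasure ν] (c : X → Γ → X → ℝ) (Cc : ℝ),
      Measurable (fun q : X × Γ × X => c q.1 q.2.1 q.2.2) → (∀ x γ x', 0 ≤ c x γ x' ∧ c x γ x' ≤ Cc) →
    ∀ (r a b' N : ℕ) [NeZero N], N = 2 * r + a + b' + 4 + 2 →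
    ∀ (α β : (Fin (r + 2) → X) → (Fin (r + 1) → Γ) → ℝ) (Cα Cβ : ℝ),
      Measurable (fun q : (Fin (r + 2) → X) × (Fin (r + 1) → Γ) => α q.1 q.2) →
      Measurable (fun q : (Fin (r + 2) → X) × (Fin (r + 1) → Γ) => β q.1 q.2) →
      (∀ W γs, |α W γs| ≤ Cα) → (∀ W γs, |β W γs| ≤ Cβ) →
    ∀ (K Xa Xb : X → X → ℝ), (∀ x x' : X, K x x' = ∫ γ, c x γ x' ∂ν) →
      (∀ u u' : X, Xa u u' = ∫ v : Fin r → X, ∫ γs : Fin (r + 1) → Γ, α (Fin.cons u (Fin.snoc v u')) γs * ∏ i : Fin (r + 1), c ((Fin.cons u (Fin.snoc v u') : Fin (r + 2) → X) (Fin.castSucc i)) (γs i) ((Fin.cons u (Fin.snoc v u') : Fin (r + 2) → X) (Fin.succ i)) ∂(Measure.pi fun _ => ν) ∂(Measure.pi fun _ => μ)) →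
      (∀ u u' : X, Xb u u' = ∫ v : Fin r → X, ∫ γs : Fin (r + 1) → Γ, β (Fin.cons u (Fin.snoc v u')) γs * ∏ i : Fin (r + 1), c ((Fin.cons u (Fin.snoc v u') : Fin (r + 2) → X) (Fin.castSucc i)) (γs i) ((Fin.cons u (Fin.snoc v u') : Fin (r + 2) → X) (Fin.succ i)) ∂(Measure.pi fun _ => ν) ∂(Measure.pi fun _ => μ)) →
    (StronglyMeasurable (Function.uncurry Xa) ∧ StronglyMeasurable (Function.uncurry Xb)) ∧
    (∀ u u' : X, |Xa u u'| ≤ Cα * (∫ v : Fin r → X, ∏ i : Fin (r + 1), K ((Fin.cons u (Fin.snoc v u') : Fin (r + 2) → X) (Fin.castSucc i)) ((Fin.cons u (Fin.snoc v u') : Fin (r + 2) → X) (Fin.succ i)) ∂(Measure.pi fun _ => μ)) ∧ |Xb u u'| ≤ Cβ * (∫ v : Fin r → X, ∏ i : Fin (r + 1), K ((Fin.cons u (Fin.snoc v u') : Fin (r + 2) → X) (Fin.castSucc i)) ((Fin.cons u (Fin.snoc v u') : Fin (r + 2) → X) (Fin.succ i)) ∂(Measure.pi fun _ => μ))) ∧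
    (∀ u u' : X, |Xa u u'| ≤ Cα * Cc ^ (r + 1) ∧ |Xb u u'| ≤ Cβ * Cc ^ (r + 1)) ∧
    (∫ p : (ZMod N → X) × (ZMod N → Γ),
        α (fun i : Fin (r + 2) => p.1 ((i : ℕ) : ZMod N)) (fun i : Fin (r + 1) => p.2 ((i : ℕ) : ZMod N)) *
          β (fun i : Fin (r + 2) => p.1 ((r + a + 3 + (i : ℕ) : ℕ) : ZMod N))
            (fun i : Fin (r + 1) => p.2 ((r + a + 3 + (i : ℕ) : ℕ) : ZMod N)) *
          ∏ t : ZMod N, c (p.1 t) (p.2 t) (p.1 (t + 1))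
        ∂((Measure.pi fun _ => μ).prod (Measure.pi fun _ => ν)) =
      ∫ V : Fin (1 + (a + 2 + (b' + 1 + 1)) + 1) → X, ∏ t : Fin (1 + (a + 2 + (b' + 1 + 1)) + 1),
        (fun s : ℕ => if s = 0 then Xa else if s = a + 2 + 1 then Xb else K) (t : ℕ) (V t) (V (t + 1)) ∂(Measure.pi fun _ => μ)) ∧
    (∫ p : (ZMod N → X) × (ZMod N → Γ),
        α (fun i : Fin (r + 2) => p.1 ((i : ℕ) : ZMod N)) (fun i : Fin (r + 1) => p.2 ((i : ℕ) : ZMod N)) *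
          ∏ t : ZMod N, c (p.1 t) (p.2 t) (p.1 (t + 1))
        ∂((Measure.pi fun _ => μ).prod (Measure.pi fun _ => ν)) =
      ∫ V : Fin (1 + (r + a + b' + 4) + 1) → X, Xa (V 0) (V 1) *
        ∏ t : Fin (1 + (r + a + b' + 4)), K (V t.succ) (V (t.succ + 1)) ∂(Measure.pi fun _ => μ)) ∧
    (∫ p : (ZMod N → X) × (ZMod N → Γ), ∏ t : ZMod N, c (p.1 t) (p.2 t) (p.1 (t + 1))
        ∂((Measure.pi fun _ => μ).prod (Measure.pi fun _ => ν)) =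
      ∫ V : Fin (2 * r + a + b' + 4 + 2) → X, ∏ t : Fin (2 * r + a + b' + 4 + 2), K (V t) (V (t + 1)) ∂(Measure.pi fun _ => μ)) := by
  intro X Γ _ _ μ ν _ _ c Cc hc hcb r a b' N _ hN α β Cα Cβ hα hβ hαb hβb K Xa Xb hK hXa hXb
  obtain rfl : K = fun x x' : X => ∫ γ, c x γ x' ∂ν := funext fun x => funext fun x' => hK x x'
  obtain rfl : Xa = fun u u' : X => ∫ v : Fin r → X, ∫ γs : Fin (r + 1) → Γ, α (Fin.cons u (Fin.snoc v u')) γs * ∏ i : Fin (r + 1), c ((Fin.cons u (Fin.snoc v u') : Fin (r + 2) → X) (Fin.castSucc i)) (γs i) ((Fin.cons u (Fin.snoc v u') : Fin (r + 2) → X) (Fin.succ i)) ∂(Measure.pi fun _ => ν) ∂(Measure.pi fun _ => μ) := funext fun u => funext fun u' => hXa u u'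
  obtain rfl : Xb = fun u u' : X => ∫ v : Fin r → X, ∫ γs : Fin (r + 1) → Γ, β (Fin.cons u (Fin.snoc v u')) γs * ∏ i : Fin (r + 1), c ((Fin.cons u (Fin.snoc v u') : Fin (r + 2) → X) (Fin.castSucc i)) (γs i) ((Fin.cons u (Fin.snoc v u') : Fin (r + 2) → X) (Fin.succ i)) ∂(Measure.pi fun _ => ν) ∂(Measure.pi fun _ => μ) := funext fun u => funext fun u' => hXb u u'
  exact ⟨⟨slab_blockKernel_stronglyMeasurable hc hα, slab_blockKernel_stronglyMeasurable hc hβ⟩,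
    fun u u' => ⟨slab_blockKernel_abs_le hc hcb hαb u u', slab_blockKernel_abs_le hc hcb hβb u u'⟩,
    fun u u' => ⟨slab_blockKernel_abs_le' hc hcb hαb u u', slab_blockKernel_abs_le' hc hcb hβb u u'⟩,
    slab_cyclic_two hc hcb hα hβ hαb hβb hN,
    slab_cyclic_one hc hcb hα hαb (M := r + a + b' + 4) (by omega),
    slab_cyclic_zero hc hcb hN⟩

end Summit.QuantumFields.YangMills.Theorems.WeakCouplingHypercubicLimit.TraceNormColdPressure

end
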